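import Summits.MatrixMultiplication.OmegaCensus.STPPVosperSlackTwoCheckersT
import Summits.MatrixMultiplication.OmegaCensus.STPPVosperSlackTwoTablesZ53
import Summits.MatrixMultiplication.OmegaCensus.STPPVosperSlackTwoLawABQ

/-!
# ω-census (abelian STPP census): ℤ₅₃ leaf {(2,3,3)³} — slack-2 three-block law, case B′ rows up to dihedral symmetry, part 1 of 2 (kernel computations)

HONEST FRAMING (pub-omega census; verbatim): lottery ticket; floor = certified bounds/negative ranges.
Census STRUCTURE (seat pub-omega-stpp-2 gen 31, 2026-08-29), family (b2).  Rows for the three-block slack-2 law `no_isSTPP_of_slack_two_tables` (`STPPVosperSlackTwoLawT.lean`, stpp-1 g33) at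
the ℤ₅₃ leaf `{(2,3,3)³}`, case B′ (role-swapped family, block `(3,2,3)`, free shape = the 2-set `Q = [0, d]`): `dihedralSmaller 53 Q || caseADeadT 53 3 3 12 18 Q tblZ53B` over
`qShapes 53 2` (52 shapes, 26 dihedral representatives; python mirror 18 261 tiling nodes, HOME `pub-omega-stpp-2-g31/code/s2/`).  The regular index chunks
`[0,39)`, `[39,46)`, `[46,49)`, `[50,52)` are one `decide +kernel` each; the interval shape `Q = [0, 3]` (index `49`: pattern `P + Q = [0, 6)`, four table
leaves with `#Zc = 18 = z`, each a `sublistsLen 18` of exponential kernel cost) is decided by branches in `STPPVosperSlackTwoRows53B2.lean`.  Assembly in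
`STPPVosperSlackTwoRows53BAsm.lean`.  Nothing here is progress on `ω`.
-/

namespace Summit.MatrixMultiplication.OmegaCensus.CubeNB.S2

/-- Rows chunk `[0, 39)`: every entry passes the kernel test. [folklore] -/
theorem rows53B_c0 : ((qShapes 53 2 0 39).all fun Q => dihedralSmaller 53 Q || caseADeadT 53 3 3 12 18 Q tblZ53B) = true := by
  decide +kernel

/-- Rows chunk `[39, 46)`: every entry passes the kernel test. [folklore] -/
theorem rows53B_c1 : ((qShapes 53 2 39 46).all fun Q => dihedralSmaller 53 Q || caseADeadT 53 3 3 12 18 Q tblZ53B) = true := by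
  decide +kernel

/-- Rows chunk `[46, 49)`: every entry passes the kernel test. [folklore] -/
theorem rows53B_c2 : ((qShapes 53 2 46 49).all fun Q => dihedralSmaller 53 Q || caseADeadT 53 3 3 12 18 Q tblZ53B) = true := by
  decide +kernel

/-- Rows chunk `[50, 52)`: every entry passes the kernel test. [folklore] -/
theorem rows53B_c4 : ((qShapes 53 2 50 52).all fun Q => dihedralSmaller 53 Q || caseADeadT 53 3 3 12 18 Q tblZ53B) = true := by
  decide +kernel

end Summit.MatrixMultiplication.OmegaCensus.CubeNB.S2
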